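import Summits.QuantumFields.YangMills.Theorems.BalabanUVNodesN08AlphaEq324RowACReMassedSlotOfRecord
import Summits.QuantumFields.YangMills.Theorems.BalabanUVNodesN08AlphaEq324RowACZeroRows

/-!
# Route «BalabanUVNodes», Track-A DAG node N08 = [Balaban1985UV3] Thm 1 p. 257 ∕ Thm 2 p. 272 — THE RE-MASSED AC TOWER READ FROM THE EDITED (α)-AC CLAUSE, part 4:
# the two remaining density-currency corollaries of the slot of record from the edition (guard-recursive family; E6′ as a measure inequality), and WHAT THE TILTED ANTECEDENT
# EXCLUDES — `RunAlphaAC` forces `0 ≤ Ca` and `0 ≤ Cc` (any data), so (R4‴)∕(R4⁗)∕III-b's antecedent is EMPTY for records with `Ca < 0` or `Cc < 0`, where the edition's is not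

Cell `pub-ymgap`, seat `pub-ymgap-dag-n08-w4` gen 4 (INTENT-4; sequel of `…RowACReMassedSlotOfRecord` and of `…RowACZeroRows` p614622).  `bears_on: R4∕N08`; `--supports
stmt-QuantumFields-20542` (K1⁷, helper).  THEOREMS ONLY (def-free), sorry-free, standard axioms; dag-n08-w1's files 17∕17b∕III-b and the lane's `Balaban3D/Proofs/*AC` modules BY NAME.

* §1 ★★★ `printedUV3V_at_slotOfRecord_of_coreLTAtAC_of_guardRec_of_consts'` (the slot from the EDITED (α)-AC rows ∧ a density bound `ν_k ≤ (e^{c_m|T₁^{(k)}|} − 1)·dU_k` on a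
  guard-recursive family at print's averaging — dag-n08-w1's F17b `massRecAC_avOfPrint_le_exp_ae_of_guardRec` feeding part 3's `…_of_consts'`; III-b §3 one (α)-currency lower) ·
  ★★ `printedUV3V_at_slotOfRecord_of_coreLTAtAC_of_haarCompat_of_consts'` (`c_m = 0`, `ν = 0`: E6′ read as the levelwise measure inequality `(dU_j)∘Ū_j⁻¹ ≤ dU_{j+1}` suffices,
  with the (3.24) row in print's sandwich currency at any letter).
* §2 13C′ — WHAT THE TILTED (3.24) PAIR EXCLUDES, ANY DATA: `unit324_pos`; ★ `ca_nonneg_of_stepAlphaAC` ∕ ★ `cc_nonneg_of_stepAlphaAC` (`StepAlphaAC 𝔊 𝔠 X 𝔖 𝔄 k → 0 ≤ Ca ∧ 0 ≤ Cc`: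
  rows (3.24)(a)∕(c) bound an absolute value by `Ca·unit`, `Cc·(n̄+1)!·unit` with `unit > 0`); ★★ `not_runAlphaAC_of_ca_neg` ∕ `not_runAlphaAC_of_cc_neg` (`1 ≤ K`): for a record
  with `Ca < 0` (or `Cc < 0`) — allowed by `AlphaConsts`, which carries `0 ≤ Ca + Cc` only — the antecedent `RunAlphaAC` of p605761∕p606479∕III-b is EMPTY at every `X 𝔖 𝔄`, while the
  edition's antecedent has its zero-data inhabitant for EVERY record modulo (H) the transported residual pair and (I) the class-I rows (`…RowACZeroRows.coreLTAtAC_zero_of_pairs`):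
  `not_runAlphaAC_and_coreLTAtAC_zero_of_pairs` (side by side).  dag-n08-d's mismatch #1 (`…RowCoreZero.ca_nonneg_of_stepDataRows_zero`, zero data, Haar-compatible lane) read on
  the AC road at ANY data.  Not a defect of any landed theorem (they quantify over arbitrary `𝔠`); the printed (3.24) sentence needs `Ca + Cc ≥ 0` only.
HONEST FRAMING: count-neutral helper + typing facts; the edited (α)-AC rows and the density bounds are HYPOTHESES = N08's object gap; `PrintedUV3V` NOT proved; N08 NOT discharged; one
finite 𝕋⁴ programme at fixed ε, Bałaban AS PRINTED — R4 closes the conditional finite-𝕋⁴ rung `BalabanLadder.UV` only; the Yang–Mills mass gap (Clay) is NOT proved by any of this;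
nothing continuum ∕ ℝ⁴ ∕ OS.

References: [Balaban1985UV3] T. Bałaban, Commun. Math. Phys. 102 (1985) 255–275 — Thm 1 p. 257, Thm 2 p. 272, (41) p. 266, (58) p. 270; [Balaban1985Averaging] (13)+(15) p. 19;
[Balaban1987RG1] (0.4) p. 253; [Balaban1982Higgs1] (3.24) p. 616.
-/

noncomputable section

open MeasureTheory

namespace Summit.QuantumFields.YangMills.Theorems.BalabanUVNodesN08AlphaEq324RowACReMassedCorollaries

open scoped BigOperators Nat
open Literature.MathematicalPhysics.QuantumFieldTheory.Balaban1983to89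
open Literature.MathematicalPhysics.QuantumFieldTheory.Balaban1983to89.Node00 (SU TFamily₃)
open Literature.MathematicalPhysics.QuantumFieldTheory.Balaban1983to89.B10RunsOfRecord
open Literature.MathematicalPhysics.QuantumFieldTheory.Balaban1983to89.BlockAveraging (Small)
open Literature.MathematicalPhysics.QuantumFieldTheory.Balaban1983to89.ExpMeanLog (expMeanLogSU)
open Literature.MathematicalPhysics.QuantumFieldTheory.Balaban1985CMP102
open Literature.MathematicalPhysics.QuantumFieldTheory.Balaban1985CMP102.Setting
open Literature.MathematicalPhysics.QuantumFieldTheory.Balaban1985CMP102.Theorems (Family)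
open Summit.QuantumFields.Balaban3D
open Summit.QuantumFields.Balaban3D.Carriers (nblkOf StepSeries Hist rcolOf eps1Of epsSOf)
open Summit.QuantumFields.Balaban3D.Proofs
open Summit.QuantumFields.Balaban3D.Proofs.ScalesArithmetic (sites_nonneg sites_pos L_pos g0sq_pos)
open Summit.QuantumFields.Balaban3D.Proofs.Constants (eps0Of)
open Summit.QuantumFields.Balaban3D.Proofs.GroupModelLieC (lieC)
open Summit.QuantumFields.Balaban3D.Proofs.StandardAC (ExternalInputsAC)
open Summit.QuantumFields.Balaban3D.Proofs.MassesAC (massRecAC)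
open Summit.QuantumFields.Balaban3D.Proofs.AlphaAC (AlphaDataAC StepAlphaAC RunAlphaAC)
open Summit.QuantumFields.YangMills.BalabanUVNodes.N08MassesACLeastClosedFamilyPrint (massRecAC_avOfPrint_le_exp_ae_of_guardRec)
open Summit.QuantumFields.YangMills.Theorems.BalabanUVNodesN08AlphaZeroData (zeroRun)
open Summit.QuantumFields.YangMills.Theorems.BalabanUVNodesN08AlphaClassI (RunRowsI)
open Summit.QuantumFields.YangMills.Theorems.BalabanUVNodesN08AlphaEq324RowAC
open Summit.QuantumFields.YangMills.Theorems.BalabanUVNodesN08AlphaEq324RowACZero (zeroAlphaLTAC)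
open Summit.QuantumFields.YangMills.Theorems.BalabanUVNodesN08AlphaEq324RowACZeroRows (coreLTAtAC_zero_of_pairs)
open Summit.QuantumFields.YangMills.Theorems.BalabanUVNodesN08AlphaEq324RowACReMassedSlotOfRecord

/-! ## §1 The slot of record from the edition in density currency: guard-recursive family; E6′ as a measure inequality -/
section Density

variable {N : ℕ} [NeZero N] {L : ℕ}

variable (N L) in
/-- ★★★ **THE SLOT OF RECORD FROM THE EDITED (α)-AC ROWS AND A DENSITY BOUND ON A GUARD-RECURSIVE FAMILY AT PRINT'S AVERAGING — A6 FORM** (III-b §3 one (α)-currency lower): for every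
`SU(N)`, `𝔠`, `εbg` with `b₀p₀^{p₀}e^{1−p₀} ≤ εbg`, `c_m ≥ 0`, there are AC external inputs `X` at print's averaging pinned to the record such that, for every `𝔖`, range-honest `𝔄` and
letter `c`: the EDITED (α)-AC rows on the family ∧ «at every member, SOME family `ν` with `ν_{j+1} ≥ (dU_j↾G_j)∘Ū_j⁻¹ + ν_j∘Ū_j⁻¹` (`j + 1 ≤ K`) and `ν_k ≤ (e^{c_m|T₁^{(k)}|} − 1)·dU_k` (`k ≤ K`)»
⇒ `Node00.PrintedUV3V N L`. [cite: Balaban1985UV3, Thm 1 p.257 + Thm 2 p.272 + (41) p.266; Balaban1985Averaging, (15) p.19; Balaban1987RG1, (0.4) p.253; Balaban1982Higgs1, (3.24) p.616] -/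
theorem printedUV3V_at_slotOfRecord_of_coreLTAtAC_of_guardRec_of_consts' (𝔊 : GroupModel (SU N)) (𝔠 : Primitives.AlphaConsts L 𝔊.N) (εbg cm : ℝ)
    (hε : 𝔠.lane.F.b₀ * (𝔠.lane.F.p₀ ^ 𝔠.lane.F.p₀ * Real.exp (1 - 𝔠.lane.F.p₀)) ≤ εbg) (hcm : 0 ≤ cm) :
    ∃ X : ∀ S : Scales L, ExternalInputsAC S (SU N), (∀ S, (X S).av = avOfPrint N S) ∧
      ∀ (𝔖 : ∀ (S : Scales L) (k : ℕ), StepSeries S (SU N) ↥(lieC 𝔊) (nblkOf S 𝔠.lane.carrier k) k)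
        (𝔄 : ∀ S : Scales L, AlphaDataLTAC 𝔊 𝔠 (X S) (𝔖 S))
        (c : ∀ (S : Scales L) (k : ℕ), Hist S.P (k + 1) → GaugeField S.P (k + 1) (SU N) → ℕ → ℝ),
        (∀ S : Family L (eps0Of 𝔠.gamma0), RunAlphaEq324CoreLTAtAC 𝔊 𝔠 (X S.1) (𝔖 S.1) (𝔄 S.1) (c S.1)) →
        (∀ S : Family L (eps0Of 𝔠.gamma0), ∃ ν : ∀ k, Measure (GaugeField S.1.P k (SU N)),
          (∀ j, j + 1 ≤ S.1.K →
            ((fieldMeasure S.1.P j (SU N)).restrict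
                {U : GaugeField S.1.P j (SU N) | ∃ c : PBond S.1.P (j + 1), Small (expMeanLogSU : LoopAverage (SU N)) U c}).map (avOfPrint N S.1 j).avg +
              (ν j).map (avOfPrint N S.1 j).avg ≤ ν (j + 1)) ∧
          (∀ k, k ≤ S.1.K → ν k ≤ ENNReal.ofReal (Real.exp (cm * S.1.sites k) - 1) • fieldMeasure S.1.P k (SU N))) →
        Node00.PrintedUV3V N L := by
  obtain ⟨X, hav, h⟩ := printedUV3V_at_slotOfRecord_of_coreLTAtAC_of_massBoundAE_of_consts' N L 𝔊 𝔠 εbg cm hε hcm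
  refine ⟨X, hav, fun 𝔖 𝔄 c R hν => h 𝔖 𝔄 c R fun S k hk1 hkK hh => ?_⟩
  obtain ⟨ν, hrec, hνc⟩ := hν S
  exact massRecAC_avOfPrint_le_exp_ae_of_guardRec N S.1 𝔠.lane.carrier.M₁ (rcolOf S.1 𝔠.lane.carrier) (eps1Of S.1 𝔠.lane.carrier) (epsSOf S.1 𝔠.lane.carrier)
    ν hrec (fun k => cm * S.1.sites k) (fun k => mul_nonneg hcm (sites_nonneg S.1 k)) hνc k hkK hh

variable (N L) in
/-- ★★ **COROLLARY — E6′ READ AS A MEASURE INEQUALITY SUFFICES, WITH THE (3.24) ROW IN PRINT'S SANDWICH CURRENCY** (`c_m = 0`, `ν := 0` in part 3's weakly-closed form): the EDITED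
(α)-AC rows on the family ∧ «`(dU_j)∘Ū_j⁻¹ ≤ dU_{j+1}` for `j < K` at every member» ⇒ `Node00.PrintedUV3V N L` (III-b's `…_of_haarCompat_of_consts'` one (α)-currency lower).
[cite: Balaban1985UV3, Thm 1 p.257 + Thm 2 p.272; Balaban1985Averaging, (13)+(15) p.19; Balaban1982Higgs1, (3.24) p.616] -/
theorem printedUV3V_at_slotOfRecord_of_coreLTAtAC_of_haarCompat_of_consts' (𝔊 : GroupModel (SU N)) (𝔠 : Primitives.AlphaConsts L 𝔊.N) (εbg : ℝ)
    (hε : 𝔠.lane.F.b₀ * (𝔠.lane.F.p₀ ^ 𝔠.lane.F.p₀ * Real.exp (1 - 𝔠.lane.F.p₀)) ≤ εbg) :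
    ∃ X : ∀ S : Scales L, ExternalInputsAC S (SU N), (∀ S, (X S).av = avOfPrint N S) ∧
      ∀ (𝔖 : ∀ (S : Scales L) (k : ℕ), StepSeries S (SU N) ↥(lieC 𝔊) (nblkOf S 𝔠.lane.carrier k) k)
        (𝔄 : ∀ S : Scales L, AlphaDataLTAC 𝔊 𝔠 (X S) (𝔖 S))
        (c : ∀ (S : Scales L) (k : ℕ), Hist S.P (k + 1) → GaugeField S.P (k + 1) (SU N) → ℕ → ℝ),
        (∀ S : Family L (eps0Of 𝔠.gamma0), RunAlphaEq324CoreLTAtAC 𝔊 𝔠 (X S.1) (𝔖 S.1) (𝔄 S.1) (c S.1)) →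
        (∀ S : Family L (eps0Of 𝔠.gamma0), ∀ j, j < S.1.K →
          (fieldMeasure S.1.P j (SU N)).map (avOfPrint N S.1 j).avg ≤ fieldMeasure S.1.P (j + 1) (SU N)) →
        Node00.PrintedUV3V N L := by
  obtain ⟨X, hav, h⟩ := printedUV3V_at_slotOfRecord_of_coreLTAtAC_of_weakClosed_of_consts' N L 𝔊 𝔠 εbg 0 hε le_rfl
  refine ⟨X, hav, fun 𝔖 𝔄 c R hH => h 𝔖 𝔄 c R fun S => ⟨fun _ => 0, fun k hk => ?_, fun k _ => Measure.zero_le _⟩⟩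
  rw [add_zero, add_zero]
  exact hH S k hk

end Density

/-! ## §2 13C′ — what the tilted (3.24) pair of `RunAlphaAC` excludes, at any data -/
section Tilted

variable {L : ℕ} {S : Scales L} {G : Type} [GaugeGroup G] [MeasurableSpace G] [HaarData G] {𝔊 : GroupModel G} {𝔠 : Primitives.AlphaConsts L 𝔊.N}
  {X : ExternalInputsAC S G} {𝔖 : ∀ k, StepSeries S G ↥(lieC 𝔊) (nblkOf S 𝔠.lane.carrier k) k} {𝔄 : AlphaDataAC 𝔊 𝔠 X 𝔖}

omit [HaarData G] in
/-- The (3.24) unit `(Lᵏg₀²)^{3+κ₀}·|T₁^{(k)}|` is POSITIVE. [cite: Balaban1982Higgs1, (3.24) p.616 (bookkeeping)] -/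
theorem unit324_pos (𝔠 : Primitives.AlphaConsts L 𝔊.N) (k : ℕ) : 0 < ((L : ℝ) ^ k * S.g0sq) ^ (3 + 𝔠.κ₀) * S.sites k :=
  mul_pos (Real.rpow_pos_of_pos (mul_pos (pow_pos (L_pos S) _) (g0sq_pos S)) _) (sites_pos S k)

/-- ★ **THE TILTED ROW (3.24)(a) FORCES `0 ≤ Ca`, AT ANY DATA**: `StepAlphaAC … k` bounds `|log μ(box)| ≥ 0` by `Ca·unit` with `unit > 0`. [cite: Balaban1982Higgs1, (3.24) p.616; Balaban1985UV3, (58) p.270] -/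
theorem ca_nonneg_of_stepAlphaAC {k : ℕ} (A : StepAlphaAC 𝔊 𝔠 X 𝔖 𝔄 k) : 0 ≤ 𝔠.Ca := by
  have h := (abs_nonneg _).trans (A.h324a (Hist.triv S.P (k + 1)) (fun _ => 1))
  rw [mul_assoc] at h
  exact (mul_nonneg_iff_of_pos_right (unit324_pos 𝔠 k)).mp h

/-- ★ **THE TILTED ROW (3.24)(c) FORCES `0 ≤ Cc`, AT ANY DATA**: `StepAlphaAC … k` bounds `|∂ₜ^{n̄+1} cgf(0)| ≥ 0` by `Cc·(n̄+1)!·unit`. [cite: Balaban1982Higgs1, (3.24) p.616; Balaban1985UV3, (58) p.270] -/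
theorem cc_nonneg_of_stepAlphaAC {k : ℕ} (A : StepAlphaAC 𝔊 𝔠 X 𝔖 𝔄 k) : 0 ≤ 𝔠.Cc := by
  have h := (abs_nonneg _).trans (A.h324c (Hist.triv S.P (k + 1)) (fun _ => 1) 0 ⟨le_rfl, zero_le_one⟩)
  have hfac : (0 : ℝ) < ((𝔠.nbar + 1).factorial : ℝ) := by exact_mod_cast Nat.factorial_pos _
  rw [mul_assoc, mul_assoc] at h
  exact (mul_nonneg_iff_of_pos_right (mul_pos hfac (unit324_pos 𝔠 k))).mp h

/-- ★★ **FOR A RECORD WITH `Ca < 0` THE (α)-AC CLAUSE AS LANDED IS EMPTY** at every lattice approximation with a run (`1 ≤ K`) and every `X 𝔖 𝔄`: the antecedent `RunAlphaAC` of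
p605761∕p606479∕III-b holds for NO data.  LOCATED typing looseness, not a defect (those theorems quantify over arbitrary `𝔠`; the printed (3.24) sentence needs `Ca + Cc ≥ 0` only,
which `AlphaConsts.Cac_nonneg` carries). [cite: Balaban1982Higgs1, (3.24) p.616; Balaban1985UV3, (41) p.266 (bookkeeping over the typed clause)] -/
theorem not_runAlphaAC_of_ca_neg (hK : 1 ≤ S.K) (hCa : 𝔠.Ca < 0) : ¬ RunAlphaAC 𝔊 𝔠 X 𝔖 𝔄 := fun R =>
  absurd (ca_nonneg_of_stepAlphaAC (R.steps 0 (by omega))) (not_le.2 hCa)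

/-- … and likewise for `Cc < 0`. [cite: Balaban1982Higgs1, (3.24) p.616 (bookkeeping)] -/
theorem not_runAlphaAC_of_cc_neg (hK : 1 ≤ S.K) (hCc : 𝔠.Cc < 0) : ¬ RunAlphaAC 𝔊 𝔠 X 𝔖 𝔄 := fun R =>
  absurd (cc_nonneg_of_stepAlphaAC (R.steps 0 (by omega))) (not_le.2 hCc)

omit 𝔖 𝔄 in
/-- **SIDE BY SIDE** (13C′ with part 1 of this gen): for a record with `Ca < 0` (so `Cc > 0`, `Ca + Cc ≥ 0`), at a family member with a run, the AC clause AS LANDED has NO instance for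
ANY expansion data and ANY `𝔄 : AlphaDataAC`, while the EDITED clause at the zero series has its inhabitant `zeroAlphaLTAC` for every letter with vanishing sums, modulo (H) the transported
residual pair and (I) the class-I rows at the axial companion. [cite: Balaban1985UV3, (41) p.266 (bookkeeping); Balaban1982Higgs1, (3.24) p.616] -/
theorem not_runAlphaAC_and_coreLTAtAC_zero_of_pairs [MeasurableMul₂ G] (hK : 1 ≤ S.K) (hCa : 𝔠.Ca < 0) (hle : S.g ^ 2 * S.ε₀ ≤ 1)
    (c : ∀ k, Hist S.P (k + 1) → GaugeField S.P (k + 1) G → ℕ → ℝ)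
    (hsum : ∀ k, k + 1 ≤ S.K → ∀ h (U : GaugeField S.P (k + 1) G), ∑ n ∈ Finset.Icc 1 𝔠.nbar, c k h U n / (n.factorial : ℝ) = 0)
    (H : ∀ k, k + 1 ≤ S.K →
      (∀ h' : Hist S.P (k + 1), Bound55AC.Fibre49AC X 𝔠.lane.carrier (zeroRun 𝔊 𝔠) (fun _ => True) k (InputsAC.piecesWAC 𝔠.lane X (zeroRun 𝔊 𝔠) k) h') ∧
        Bound55AC.Fibre57LowAC X 𝔠.lane.carrier (zeroRun 𝔊 𝔠) (fun _ => True) k (InputsAC.piecesWAC 𝔠.lane X (zeroRun 𝔊 𝔠) k))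
    (I : RunRowsI 𝔊 𝔠 X.axialCompanion (zeroRun 𝔊 𝔠)) :
    (∀ (𝔖' : ∀ k, StepSeries S G ↥(lieC 𝔊) (nblkOf S 𝔠.lane.carrier k) k) (𝔄' : AlphaDataAC 𝔊 𝔠 X 𝔖'), ¬ RunAlphaAC 𝔊 𝔠 X 𝔖' 𝔄') ∧
      ∃ 𝔄₀ : AlphaDataLTAC 𝔊 𝔠 X (zeroRun 𝔊 𝔠), RunAlphaEq324CoreLTAtAC 𝔊 𝔠 X (zeroRun 𝔊 𝔠) 𝔄₀ c :=
  ⟨fun _ _ => not_runAlphaAC_of_ca_neg hK hCa, coreLTAtAC_zero_of_pairs 𝔊 𝔠 X c hle hsum H I⟩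

end Tilted

end Summit.QuantumFields.YangMills.Theorems.BalabanUVNodesN08AlphaEq324RowACReMassedCorollaries

end
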